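import Literature.Computability.QuantumComplexity.PermanentReductionMachine
import Literature.Computability.Complexity.ParsimoniousThreeCNFMachine
import Literature.Computability.Complexity.SharpSATNormalFormFP
import Literature.Computability.Complexity.KannanLanguage
import HarnessLib

/-!
# Valiant's theorem: the `0/1` permanent is `#P`-hard — discharge of `permanent01_isSharpPHardFun`

L. G. Valiant, *The complexity of computing the permanent*, Theoret. Comput. Sci. 8 (1979), Thm. 1:
"the problem of computing the permanent of a `(0,1)`-matrix is `#P`-complete" (hardness under
polynomial-time Turing reductions). The tree records the theorem as the two equivalent named facts
`Literature.Computability.QuantumComplexity.permanent01_isSharpPHardFun` (`PermanentHardness.lean`,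
structured codes `encodingIntMatrix`) and
`Literature.Computability.AlgebraicComplexity.Valiant1979_per01Plain_isSharpPHardFun`
(`PermanentBitsPPoly.lean`, row-major words; the equivalence is `PermanentCodeTranscoder.lean`).
This file proves both:

* `Literature.Computability.AlgebraicComplexity.Valiant1979_per01Plain_isSharpPHardFun_holds`,
* `Literature.Computability.QuantumComplexity.permanent01_isSharpPHardFun_holds`.

The proof is a one-query Turing reduction from `#3SAT` (complete for `#P` under parsimonious
reductions, `sharpP_parsimoniousReducible_SHARP3SAT`, LOT2003 Prop. 2 — proved in the tree by the
parsimonious Cook–Levin theorem): for a 3CNF `ψ` with `m` clauses the machine `PerRedFP.preF`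
(`PermanentReductionMachine.lean`, `preF ∈ FP`) writes the row-major word of the `0/1` matrix
`bMatrix ψ` (`PermanentReductionCodes.lean`: the two-site arithmetisation `CNFPermanentTwoSite.lean`,
`per = 2^{6m} #SAT`, lifted to `0/1` modulo `2^{9m}+1`, `PermanentZeroOneLift.lean`), one oracle
call returns its permanent `N`, and the post-processing `PerRedPost.postF ∈ FP` outputs
`bin ((N mod (2^{9m}+1)) / 2^{6m}) = bin (#SAT ψ)` (`PerRed.numSat_eq_per01PlainFn`); strings that do
not code a 3CNF are sent to the non-square word `00` (permanent function `0 = #3SAT`). The oracle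
machine itself is the tree's `postPre_mem_FPRel` / `self_mem_FPRel` (`OracleClosure.lean`,
`CountingProofs.lean`).

## References

* L. G. Valiant, *The complexity of computing the permanent*, Theoret. Comput. Sci. 8 (1979)
  189–201, Thm. 1, Lemma 3.1, Lemma 3.3, §4.
* C. H. Papadimitriou, *Computational Complexity*, 1994, Thm. 18.3 (single modulus `2^q + 1`).
* M. Liśkiewicz, M. Ogihara, S. Toda, TCS 304 (2003), Prop. 2 (`#3SAT` parsimoniously complete).
* S. Arora, B. Barak, *Computational Complexity: A Modern Approach*, CUP 2009, §17.3.1 (`FP^f`,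
  `#P`-completeness under oracle reductions), §1.3.
-/

noncomputable section

namespace Literature.Computability.QuantumComplexity

open _root_.Computability Literature.Computability.Complexity Literature.Computability.AlgebraicComplexity
  Brick OracleCompose Plumb Polynomial

namespace PerRedPost

/-! ### The arithmetic post-processing `⟨w, a⟩ ↦ bin ((val a % (2^{9m} + 1)) / 2^{6m})` -/

/-- The number of clauses `m` of the formula `decCNF w`, in unary, from `w`. [folklore] -/
def mUF : List Bool → List Bool := fstF ∘ KSATRed.canonCNFFn

/-- `mUF w = 1ᵐ`. [folklore] -/
theorem mUF_apply (w : List Bool) : mUF w = ones (NegCNF.decCNF w).length := by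
  rw [mUF, Function.comp_apply, KSATRed.canonCNFFn_eq, SharpSATVerif.encode_cnf, fstF_boolPair,
    OracleCompose.unaryEncodeNat_eq_replicate]

/-- `mUF ∈ FP`. [folklore] -/
theorem mUF_mem_FP : mUF ∈ FP := comp_mem_FP fstF_mem_FP KSATRed.canonCNFFn_mem_FP

/-- The numeral of `2^{c·|u|}` from `u`: `0^{c|u|} 1`. [folklore] -/
def pow2F (c : ℕ) : List Bool → List Bool := fun u => Kannan.zerosFn (polyFn (C c * X) u) ++ [true]

/-- `val (pow2F c u) = 2^{c |u|}`. [folklore] -/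
theorem bitsToNat_pow2F (c : ℕ) (u : List Bool) : bitsToNat (pow2F c u) = 2 ^ (c * u.length) := by
  rw [pow2F, bitsToNat_append, Kannan.zerosFn_apply, bitsToNat_replicate_false, List.length_replicate, polyFn_apply]
  simp [ones]

/-- `pow2F c ∈ FP`. [folklore] -/
theorem pow2F_mem_FP (c : ℕ) : pow2F c ∈ FP :=
  append_mem_FP (comp_mem_FP Kannan.zerosFn_mem_FP (polyFn_mem_FP _)) (const_mem_FP [true])

/-- **The post-processing** on `z = ⟨w, a⟩`: with `m` the number of clauses of `decCNF w`,
`bin ((val a % (2^{9m} + 1)) / 2^{6m})`. [cite: Valiant1979, Thm. 1] -/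
def postF : List Bool → List Bool :=
  divFn ∘ fanoutFn
    (remFn ∘ fanoutFn sndF (addFn ∘ fanoutFn (pow2F 9 ∘ mUF ∘ fstF) fun _ => [true]))
    (pow2F 6 ∘ mUF ∘ fstF)

/-- `postF ∈ FP`. [folklore] -/
theorem postF_mem_FP : postF ∈ FP :=
  comp_mem_FP divFn_mem_FP (fanoutFn_mem_FP
    (comp_mem_FP remFn_mem_FP (fanoutFn_mem_FP sndF_mem_FP
      (comp_mem_FP addFn_mem_FP (fanoutFn_mem_FP
        (comp_mem_FP (pow2F_mem_FP 9) (comp_mem_FP mUF_mem_FP fstF_mem_FP)) (const_mem_FP _)))))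
    (comp_mem_FP (pow2F_mem_FP 6) (comp_mem_FP mUF_mem_FP fstF_mem_FP)))

/-- **Value of the post-processing** on `⟨w, bin N⟩`. [cite: Valiant1979, Thm. 1] -/
theorem postF_apply (w : List Bool) (N : ℕ) :
    postF (boolPair w (encodeNat N)) =
      encodeNat (N % (2 ^ ((NegCNF.decCNF w).length * 9) + 1) / 2 ^ ((NegCNF.decCNF w).length * 6)) := by
  simp only [postF, Function.comp_apply, fanoutFn_apply, fstF_boolPair, sndF_boolPair, addFn_boolPair,
    remFn_boolPair, divFn_boolPair, bitsToNat_encodeNat, bitsToNat_pow2F, mUF_apply, List.length_replicate]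
  have h1 : bitsToNat [true] = 1 := by decide
  rw [h1, Nat.mul_comm 9, Nat.mul_comm 6]

/-! ### Assembly -/

/-- **One-query Turing reductions from `#3SAT`**: if `pre, post ∈ FP` and on EVERY string
`bin (#3SAT w) = post ⟨w, bin (PER (pre w))⟩` (`PER = per01PlainFn`), then the row-major `0/1`
permanent is `#P`-hard — every `#P` function is `#3SAT ∘ R` with `R ∈ FP`
(`sharpP_parsimoniousReducible_SHARP3SAT`), and `x ↦ post ⟨R x, PER (pre (R x))⟩` is an
`FP^{PER}` computation (`self_mem_FPRel`, `postPre_mem_FPRel`, `comp_FP_mem_FPRel`). [cite: Valiant1979, Thm. 1] -/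
theorem isSharpPHardFun_per01Plain_of_reduction {pre post : List Bool → List Bool} (hpre : pre ∈ FP)
    (hpost : post ∈ FP)
    (h : ∀ w, encodeNat (SHARP3SAT w) = post (boolPair w (encodeNat (per01PlainFn (pre w))))) :
    IsSharpPHardFun per01PlainFn := by
  intro g hg
  obtain ⟨R, hR, hgR⟩ := sharpP_parsimoniousReducible_SHARP3SAT hg
  have h1 : (fun w => post (boolPair w (Oracle.ofFun per01PlainFn (pre w)))) ∈ FPRel (Oracle.ofFun per01PlainFn) :=
    postPre_mem_FPRel (self_mem_FPRel _) hpre hpost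
  have h2 := comp_FP_mem_FPRel h1 hR
  have he : (encodeNat ∘ g) = (fun w => post (boolPair w (Oracle.ofFun per01PlainFn (pre w)))) ∘ R := by
    funext x
    simp only [Function.comp_apply, Oracle.ofFun_apply, hgR x]
    exact h (R x)
  rw [he]
  exact h2

/-! ### The reduction identity and Valiant's theorem -/

open PerRedFP in
/-- **The reduction identity on every string**:
`bin (#3SAT w) = postF ⟨w, bin (PER (preF w))⟩` with `PER = per01PlainFn`. [cite: Valiant1979, Thm. 1] -/
theorem reduction_identity (w : List Bool) :
    encodeNat (SHARP3SAT w) = postF (boolPair w (encodeNat (per01PlainFn (preF w)))) := by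
  rw [SHARP3SAT_eq_decCNF, preF_apply, postF_apply]
  by_cases h : CNF.IsWidthEq 3 (NegCNF.decCNF w)
  · rw [if_pos h, if_pos h, PerRed.numSat_eq_per01PlainFn _ h]
  · have hs : Nat.sqrt 2 = 1 := by symm; rw [Nat.eq_sqrt]; decide
    rw [if_neg h, if_neg h, per01PlainFn_of_not_sq (by rw [show ([false, false] : List Bool).length = 2 from rfl, hs]; decide),
      Nat.zero_mod, Nat.zero_div]

end PerRedPost

end Literature.Computability.QuantumComplexity

/-- **Valiant's theorem (TCS 8 (1979), Thm. 1), row-major transcription, DISCHARGED**: the `0/1`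
permanent function `per01PlainFn` is `#P`-hard under polynomial-time Turing reductions. [cite: Valiant1979, Thm. 1] -/
theorem Literature.Computability.AlgebraicComplexity.Valiant1979_per01Plain_isSharpPHardFun_holds :
    Literature.Computability.AlgebraicComplexity.Valiant1979_per01Plain_isSharpPHardFun :=
  Literature.Computability.QuantumComplexity.PerRedPost.isSharpPHardFun_per01Plain_of_reduction
    Literature.Computability.QuantumComplexity.PerRedFP.preF_mem_FP
    Literature.Computability.QuantumComplexity.PerRedPost.postF_mem_FP
    Literature.Computability.QuantumComplexity.PerRedPost.reduction_identity

/-- **Valiant's theorem (TCS 8 (1979), Thm. 1), DISCHARGED**: the permanent of `0/1` matrices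
(structured codes, `per01Fn`) is `#P`-hard under polynomial-time Turing reductions — every `#P`
function is computable in polynomial time with one oracle call to the `0/1` permanent
(via `PermanentCodeTranscoder.permanent01_isSharpPHardFun_of_per01Plain`). [cite: Valiant1979, Thm. 1] -/
theorem Literature.Computability.QuantumComplexity.permanent01_isSharpPHardFun_holds :
    Literature.Computability.QuantumComplexity.permanent01_isSharpPHardFun :=
  Literature.Computability.AlgebraicComplexity.permanent01_isSharpPHardFun_of_per01Plain
    Literature.Computability.AlgebraicComplexity.Valiant1979_per01Plain_isSharpPHardFun_holds
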